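import Mathlib.RingTheory.GradedAlgebra.Radical
import Mathlib.Algebra.Order.Group.PiLex
import Mathlib.Order.PiLex
import Mathlib.RingTheory.Ideal.MinimalPrime.Basic
import Summits.ResolutionOfSingularities.ResolutionOfSingularities.Theorems.WeightedInvariantSingularLocusHomogeneous
import HarnessLib

/-!
# Irreducible components of a homogeneous closed set are homogeneous (torus charts of the door, `ℤʲ`-gradings)

Route `ResolutionOfSingularities/WeightedInvariant`, door crux `HypersurfaceCentreConstruction`
(stmt-ResolutionOfSingularities-19897), e-ladder plan of `res-L1-w43-stub-10` (cell res-hironaka,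
`D/res-D-pv-025/DOOR-ELADDER-PLAN.md`, lemma L3 (β) / clause (c2)): the `(hom)` clause of an admissible centre
(`IsAdmissibleCentre`, every piece homogeneous for every `ℤʲ`-grading of every affine chart making the
hypersurface ideal homogeneous) is met by centres that are UNIONS OF IRREDUCIBLE COMPONENTS of closed sets built
intrinsically from the pair — because a grading is a CONNECTED torus, which fixes each component.  In graded-ring
language: minimal primes over a homogeneous ideal are homogeneous.  Mathlib proves this
(`Ideal.IsPrime.homogeneousCore`, `Ideal.IsHomogeneous.radical`) for gradings by a LINEARLY ORDERED cancellative
monoid; the door's gradings are indexed by `Fin j → ℤ`, whose instance order is the product order, so this file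
transports along the lexicographic order `Lex (Fin j → ℤ)` (re-packaged with the decidability instance the
gradings are elaborated with):

* `isHomogeneous_of_mem_minimalPrimes_of_linearOrder` — linearly ordered index monoid: a minimal prime over a
  homogeneous ideal is homogeneous (its homogeneous core is a prime between the ideal and it);
* `isHomogeneous_of_mem_minimalPrimes` — the same for `ℤʲ`-gradings `𝒜 : (Fin j → ℤ) → AddSubgroup A`;
  `isHomogeneous_radical` — the radical of a homogeneous ideal is homogeneous (`ℤʲ`-gradings);
* `isHomogeneous_of_mem_minimalPrimes_vanishingIdeal_singSet` — with res-type-025's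
  `vanishingIdeal_singSet_isHomogeneous` (`Theorems/…SingularLocusHomogeneous.lean`): on a graded affine chart
  `W` of `f : Y → Spec k` (locally of finite type) with `X(W)` homogeneous, every minimal prime over the reduced
  ideal `𝓘(Sing V(X))(W)` — the chart ideal of an IRREDUCIBLE COMPONENT of the non-regular locus meeting `W` —
  is homogeneous.  This is the mechanism by which history-dependent but component-valued centre choices
  (Cossart–Jannsen–Saito's labelled components, e = 2; the closed singular orbits of Abramovich–Quek–Schober,
  e = 1) satisfy `(hom)` for ALL chart gradings.

Pure algebra + one composition; nothing here is a claim about Hironaka's problem.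
-/

noncomputable section

open CategoryTheory AlgebraicGeometry TopologicalSpace
open Literature.AlgebraicGeometry.Resolution

set_option linter.dupNamespace false -- mandated namespace of this single-conjunct summit

namespace Summit.ResolutionOfSingularities.ResolutionOfSingularities.Theorems

/-! ## Linearly ordered index monoid (Mathlib's setting) -/

section LinearOrder

variable {ι A : Type*} [CommRing A] [AddCommMonoid ι] [LinearOrder ι] [IsOrderedCancelAddMonoid ι]
  (𝒜 : ι → AddSubgroup A) [GradedRing 𝒜]

/-- **A minimal prime over a homogeneous ideal is homogeneous** (grading by a linearly ordered cancellative
additive monoid): the homogeneous core of the prime `P` is prime (`Ideal.IsPrime.homogeneousCore`), contains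
the homogeneous ideal `I` and is contained in `P`, so equals `P` by minimality. [folklore] -/
theorem isHomogeneous_of_mem_minimalPrimes_of_linearOrder {I P : Ideal A} (hI : I.IsHomogeneous 𝒜)
    (hP : P ∈ I.minimalPrimes) : P.IsHomogeneous 𝒜 := by
  have hPprime : P.IsPrime := hP.1.1
  have hIP : I ≤ P := hP.1.2
  have hQprime : (P.homogeneousCore 𝒜).toIdeal.IsPrime := hPprime.homogeneousCore
  have hIQ : I ≤ (P.homogeneousCore 𝒜).toIdeal := by
    rw [← hI.toIdeal_homogeneousCore_eq_self]
    exact Ideal.homogeneousCore_mono 𝒜 hIP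
  have hQP : (P.homogeneousCore 𝒜).toIdeal ≤ P := Ideal.toIdeal_homogeneousCore_le 𝒜 P
  have hPQ : P ≤ (P.homogeneousCore 𝒜).toIdeal := hP.2 ⟨hQprime, hIQ⟩ hQP
  rw [← le_antisymm hQP hPQ]
  exact (P.homogeneousCore 𝒜).isHomogeneous

end LinearOrder

/-! ## `ℤʲ`-gradings (the door's torus charts) -/

section Pi

variable {j : ℕ} {A : Type*} [CommRing A] (𝒜 : (Fin j → ℤ) → AddSubgroup A) [GradedRing 𝒜]

/-- **A minimal prime over a homogeneous ideal of a `ℤʲ`-graded ring is homogeneous.**  Transport of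
`isHomogeneous_of_mem_minimalPrimes_of_linearOrder` along the lexicographic order on `ℤʲ` (`Pi.Lex`: a linear
order since `Fin j` is well-ordered, an ordered cancellative monoid coordinatewise), re-packaged so that its
decidability instance is the one the grading `𝒜` was elaborated with. [folklore] -/
theorem isHomogeneous_of_mem_minimalPrimes {I P : Ideal A} (hI : I.IsHomogeneous 𝒜)
    (hP : P ∈ I.minimalPrimes) : P.IsHomogeneous 𝒜 := by
  -- the decidability instance of the grading (captured before any linear order is in scope)
  let decPi : DecidableEq (Fin j → ℤ) := inferInstance
  -- the lexicographic order on `ℤʲ`, re-packaged with that decidability instance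
  let loLex : LinearOrder (Fin j → ℤ) := (inferInstance : LinearOrder (Lex (Fin j → ℤ)))
  letI lo : LinearOrder (Fin j → ℤ) :=
    { loLex with
      toDecidableEq := decPi
      compare_eq_compareOfLessAndEq := fun a b => by
        rw [loLex.compare_eq_compareOfLessAndEq a b]
        congr 1 }
  have inst : @IsOrderedCancelAddMonoid (Fin j → ℤ) _ lo.toPartialOrder.toPreorder :=
    (inferInstance : IsOrderedCancelAddMonoid (Lex (Fin j → ℤ)))
  let gr : @GradedRing (Fin j → ℤ) A (AddSubgroup A) (fun a b => lo.toDecidableEq a b) _ _ _ _ 𝒜 :=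
    ‹GradedRing 𝒜›
  have hI' : @Ideal.IsHomogeneous (Fin j → ℤ) (AddSubgroup A) A _ _ _ 𝒜
      (fun a b => lo.toDecidableEq a b) _ gr I := hI
  have key := @isHomogeneous_of_mem_minimalPrimes_of_linearOrder (Fin j → ℤ) A _ _ lo inst 𝒜 gr I P hI' hP
  exact key

/-- **The radical of a homogeneous ideal of a `ℤʲ`-graded ring is homogeneous** (the radical is the
intersection of the minimal primes, each homogeneous). [folklore] -/
theorem isHomogeneous_radical {I : Ideal A} (hI : I.IsHomogeneous 𝒜) : I.radical.IsHomogeneous 𝒜 := by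
  rw [← Ideal.sInf_minimalPrimes]
  exact Ideal.IsHomogeneous.sInf fun P hP => isHomogeneous_of_mem_minimalPrimes 𝒜 hI hP

/-- **A prime that is minimal over a homogeneous ideal contains, with an element, all its homogeneous
components** (pointwise reading of `isHomogeneous_of_mem_minimalPrimes`). [folklore] -/
theorem decompose_mem_of_mem_minimalPrimes {I P : Ideal A} (hI : I.IsHomogeneous 𝒜)
    (hP : P ∈ I.minimalPrimes) {x : A} (hx : x ∈ P) (d : Fin j → ℤ) :
    (DirectSum.decompose 𝒜 x d : A) ∈ P :=
  isHomogeneous_of_mem_minimalPrimes 𝒜 hI hP d hx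

end Pi

/-! ## Irreducible components of the non-regular locus on a torus chart -/

/-- **Every irreducible component of the non-regular locus of `V(X)` is homogeneous on every torus chart of the
pair.**  Let `f : Y → Spec k` be locally of finite type, `X` an ideal sheaf on `Y`, `S ⊆ Y` the (closed) image
of the non-regular locus of `V(X)`, `W ⊆ Y` an affine open and `𝒜` a `ℤʲ`-grading of `Γ(Y, W)` for which `X(W)`
is homogeneous.  Then every minimal prime over the reduced ideal `𝓘(S)(W)` — the prime of `Γ(Y, W)` cutting out
an irreducible component of `S ∩ W` — is homogeneous: `𝓘(S)(W)` is homogeneous (res-type-025's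
`vanishingIdeal_singSet_isHomogeneous`) and minimal primes over a homogeneous ideal are
(`isHomogeneous_of_mem_minimalPrimes`).  Consequently a centre chosen as a union of such components — however
the choice depends on the history of a resolution sequence — has homogeneous (reduced) ideal on every torus
chart, i.e. meets the `(hom)` clause of `IsAdmissibleCentre` for its radical. [folklore] -/
theorem isHomogeneous_of_mem_minimalPrimes_vanishingIdeal_singSet {k : Type} [Field k] {Y : Scheme.{0}}
    (f : Y ⟶ Spec (.of k)) [LocallyOfFiniteType f] (X : Y.IdealSheafData) (S : Closeds Y)
    (hS : (S : Set Y) = {y : Y | ∃ x : X.subscheme, X.subschemeι x = y ∧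
      ¬ IsRegularLocalRing (X.subscheme.presheaf.stalk x)})
    {j : ℕ} (W : Y.affineOpens) (𝒜 : (Fin j → ℤ) → AddSubgroup Γ(Y, W)) [GradedRing 𝒜]
    (hX : (X.ideal W).IsHomogeneous 𝒜) {P : Ideal Γ(Y, W)}
    (hP : P ∈ ((Scheme.IdealSheafData.vanishingIdeal S).ideal W).minimalPrimes) : P.IsHomogeneous 𝒜 :=
  isHomogeneous_of_mem_minimalPrimes 𝒜 (vanishingIdeal_singSet_isHomogeneous f X S hS W 𝒜 hX) hP

end Summit.ResolutionOfSingularities.ResolutionOfSingularities.Theorems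

end
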